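import Literature.Barriers.CriticalPhenomena.LaceExpansionIsingAboveFourProofs
import Literature.Probability.LatticeModels.ModifiedSimonInequality
import Literature.Probability.LatticeModels.SusceptibilityMeanFieldBound
import HarnessLib

/-!
# `LaceExpansionIsingAboveFour` reduced to three named facts; the subcritical susceptibility of
# the spread-out Ising model

Barrier catalogue `Literature/Barriers/CriticalPhenomena/` (D-0021), reduction file of
`LaceExpansionIsingAboveFour.lean`, whose barrier is the conjunction
`LaceExpansionIsingAboveFour := NNIsing.IsingBubbleMeanField ∧ SpreadOutIsing.IsingBubbleMeanField`
`∧ SpreadOutIsing.Sakai2007_thm13_spreadOut` of three named facts (bubble condition ⇒ `γ = 1`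
for the nearest-neighbour and for the uniformly spread-out Ising model; Sakai 2007, Thm. 1.3,
spread-out case). This file PROVES `LaceExpansionIsingAboveFour_of_facts`: the barrier follows
from exactly three named inputs —

* `NNIsing.bubble_susceptibility_upper` (NEW named fact, this file) and
  `SpreadOutIsing.bubble_susceptibility_upper` (`LaceExpansionIsingAboveFourProofs.lean`):
  Aizenman's bound `B(β_c) < ∞ ⇒ χ_β ≤ C(β_c - β)⁻¹` (the random-current lower bound on
  `∂_β χ`, Aizenman 1982 / Aizenman–Graham 1983, as quoted by Sakai 2007, §1.1), and
* `SpreadOutIsing.Sakai2007_thm13_spreadOut` (Sakai 2007, Thm. 1.3, the lace expansion),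

everything else being theorems of the tree. For the nearest-neighbour conjunct (Part II) the lower
half `χ(β) ≥ (4d)⁻¹(β_c - β)⁻¹` and `0 < β_c` are `SusceptibilityMeanFieldBound.lean` /
`criticalBeta_pos_holds`. For the spread-out conjunct, `LaceExpansionIsingAboveFourProofs.lean`
reduced `SpreadOutIsing.IsingBubbleMeanField` to five named facts and proved one
(`inv_susceptibility_sub_le_holds`, the integrated Lebowitz inequality); Part I of this file PROVES
three more, from the tree:

1. `exists_pos_susceptibility_lt_top_holds` — high temperature: `χ_β < ∞` for some `β > 0`
   (any `β` with `|J| tanh β < 1`, `|J| = (2L+1)^d - 1`);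
2. `exists_forall_le_susceptibility_eq_top_holds` — low temperature, `d ≥ 2`, `L ≥ 1`: `χ_β = ∞`
   for `β ≥ β_c(ℤ^d)`, the nearest-neighbour critical point (so `critBeta d L` is a genuine
   supremum, `0 < critBeta d L ≤ β_c(ℤ^d)`);
3. `susceptibility_unbounded_below_critBeta_holds` — "The susceptibility `χ_p` is known to
   diverge as `p ↑ p_c`" (Sakai 2007, §1.1): `χ` is unbounded on `[0, β_c)`;

so that `SpreadOutIsing.IsingBubbleMeanField_of_bubble_susceptibility_upper` leaves the single
input `SpreadOutIsing.bubble_susceptibility_upper`; and, by the same finite-size criterion,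

4. `spreadOutTwoPoint_exp_decay_of_lt_critBeta` — for `d ≥ 2`, `L ≥ 1`, `0 ≤ β < β_c`:
   `G_β(z) ≤ C e^{-c‖z‖_∞}` with `c > 0` ("`G_p(x)` decays exponentially … if `p < p_c`", Sakai
   2007, §1.1; the third item of Duminil-Copin–Tassion 2016, Thm. 2.1), more generally whenever
   `χ_β < ∞` (`spreadOutTwoPoint_exp_decay_of_susceptibility_lt_top`), together with the openness
   of `{β ≥ 0 : χ_β < ∞}` (`exists_gt_susceptibility_lt_top`) and `χ_{β_c} = ∞`
   (`spreadOutSusceptibility_critBeta_eq_top`) — the subcritical inputs (summability, decay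
   `o(|x|^{-(d-2)})`, divergence at the critical point) that the deconvolution step of Sakai's
   Theorem 1.3 asks of the model.

## The arguments of Part I (for the objects of the barrier file: `spreadOutGraph`,
## `spreadOutTwoPoint = sup_n ⟨σ₀σ_x⟩^∅_{Λ_n;β}`, `spreadOutSusceptibility`, `critBeta = sup{β ≥ 0 : χ_β < ∞}`)

* (2) For `L ≥ 1` the nearest-neighbour graph is a subgraph of the range-`L` graph, so by
  Griffiths' second inequality in the couplings (`isingCorr_free_mono_graph`, Friedli–Velenik
  2017, Exercise 3.31) `⟨σ₀σ_x⟩^∅_{Λ_n;β}(ℤ^d) ≤ ⟨σ₀σ_x⟩^∅_{Λ_n;β}(range L)`; in the two monotone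
  box limits `twoPointFree d β x ≤ spreadOutTwoPoint d L β x`, hence `χ^{n.n.}_β ≤ χ_β`, and
  `χ^{n.n.}_β = ∞` for `β ≥ β_c(ℤ^d)`, `d ≥ 2` (`susceptibility_eq_top_of_criticalBeta_le`:
  Peierls' long-range order and the mean-field bound, `SusceptibilityMeanFieldBound.lean`).
* (1), (3) The finite-size criterion of Simon–Lieb in the form of Duminil-Copin–Tassion 2016
  (arXiv:1502.03050, §2.1 and §2.5): with
  `φ_β(S) = tanh β · Σ_{x ∈ S} #{y ∼ x : y ∉ S} ⟨σ₀σ_x⟩^∅_{S;β}` (`soPhi`), the tree's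
  finite-volume modified Simon inequality on an arbitrary locally finite graph
  (`isingTwoPoint_free_le_modifiedSimon`, `ModifiedSimonInequality.lean`: DCT Lemma 2.7) summed
  over the endpoint gives, in every box `Λ` and for every `v ∈ Λ`,
  `S_v^Λ ≤ |S| + φ_β(S) · max_y S_y^Λ` (`volumeSusceptibility_le_card_add`; translation of `S` to
  `S + v`, volume monotonicity into `(S + v) ∩ Λ`), whence `max_v S_v^Λ ≤ |S|/(1 - φ_β(S))`
  uniformly in `Λ` and `χ_β ≤ |S|/(1 - φ_β(S))` (`spreadOutSusceptibility_le_of_soPhi_lt_one`; DCT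
  §2.5, "`χ_n(β) ≤ |S| + φ_β(S)χ_n(β)`"). For (1) take `S = {0}`, `φ_β({0}) = |J| tanh β`. For (3):
  `0 < β_c` by (1)–(2); if `χ < M` on `[0, β_c)` then `χ_{β_c} ≤ M` (finite partial sums are
  volume limits of finite-volume sums, continuous in `β`); a finite `χ_{β_c}` makes the shell sums
  of `G_{β_c}` summable, so `φ_{β_c}(Λ_{k+L}) ≤ |J| tanh β_c · Σ_{k < j ≤ k+L} Σ_{‖x‖_∞ = j} G_{β_c}(x)`
  is `< 1` for large `k` (`exists_soPhi_box_lt_one`; only the `L` outer shells of a box have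
  neighbours outside it — the computation behind DCT Prop. 2.2 / Simon 1980); by continuity of
  the finite-volume `φ` some `β' > β_c` still has `φ_{β'}(Λ_n) < 1`, so `χ_{β'} < ∞` and
  `β' ≤ β_c` — a contradiction.
* (4) Iterating the pointwise form of the modified Simon inequality
  (`isingTwoPoint_le_soPhi_mul`: `⟨σ_aσ_z⟩_Λ ≤ φ_β(S) · max{⟨σ_yσ_z⟩_Λ : y ∉ S + a, y ∼ S + a}`),
  each step moving the starting point by at most `m + L` when `S ⊆ Λ_m`, gives
  `⟨σ_aσ_z⟩_Λ ≤ φ_β(S)^k` for `‖z - a‖_∞ > k(m + L)` uniformly in the volume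
  (`isingTwoPoint_le_soPhi_pow`), hence `G_β(z) ≤ φ_β(S)^{⌊‖z‖_∞/(m+L+1)⌋}` (DCT §2.5, "The proof
  follows by iterating `⌊n/L⌋` times this strategy").

Nothing in `LaceExpansionIsingAboveFour.lean` or `LaceExpansionIsingAboveFourProofs.lean` is
restated or modified; the new definitions are `SpreadOutIsing.soPhi` (DCT's `φ_β(S)` for the
spread-out graph; the tree's `dctIsingPhi` is its nearest-neighbour instance) and the named fact
`NNIsing.bubble_susceptibility_upper`.

## References

* A. Sakai, *Lace expansion for the Ising model*, Comm. Math. Phys. 272 (2007) 283–344,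
  arXiv:math-ph/0510093, §1.1 ("When `d ≥ 2`, there exists a unique critical inverse temperature
  `p_c ∈ (0,∞)` such that … `χ_p` is finite if `p < p_c`, while … `χ_p = ∞` if `p > p_c`"; "The
  susceptibility `χ_p` is known to diverge as `p ↑ p_c` [a82, ag83]"; "the finiteness of
  `Σ_{x∈ℤ^d} G_{p_c}(x)²` … implies that `β = 1/2`, `γ = 1` and `δ = 3` [a82, abf87, af86, ag83]")
  and Theorem 1.3 [Sakai2007].
* H. Duminil-Copin, V. Tassion, *A new proof of the sharpness of the phase transition for
  Bernoulli percolation and the Ising model*, Comm. Math. Phys. 343 (2016) 725–745,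
  arXiv:1502.03050: §2.1 (Thm. 2.1; definition of `φ_β(S)` and `β̃_c`), Prop. 2.2 ([Sim80]),
  Lemma 2.7 (modified Simon inequality), §2.5 (`χ_n(β) ≤ |S| + φ_β(S)χ_n(β)`)
  [DuminilCopinTassionCMP2016].
* H. Duminil-Copin, *100 years of the (critical) Ising model on the hypercubic lattice*, ICM 2022,
  arXiv:2208.00864, §7.1 (`(1 - B/χ)·2dχ²/(1+B) ≤ ∂_β χ ≤ 2dχ²`) [DuminilCopinICM2022].
* M. Aizenman, Comm. Math. Phys. 86 (1982) 1–48 [Aizenman1982]; M. Aizenman, R. Graham, Nucl.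
  Phys. B 225 (1983) 261–288 [AizenmanGraham1983] (not held; cited through Sakai 2007, §1.1).
* B. Simon, Comm. Math. Phys. 77 (1980) 111–126 [Simon1980]; E. H. Lieb, Comm. Math. Phys. 77
  (1980) 127–135 [Lieb1980].
* S. Friedli, Y. Velenik, *Statistical Mechanics of Lattice Systems*, CUP 2017, Thm. 3.20,
  Exercises 3.12, 3.31 [FriedliVelenik2017]. R. Peierls, Proc. Camb. Phil. Soc. 32 (1936) 477
  [Peierls1936].
-/

noncomputable section

namespace Literature.Barriers.CriticalPhenomena.SpreadOutIsing

open MeasureTheory Filter Topology Finset Literature.Probability.LatticeModels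
open scoped ENNReal BigOperators

variable {d L : ℕ}

/-! ## Part I. The subcritical susceptibility of the spread-out model

### The spread-out model dominates the nearest-neighbour model (`L ≥ 1`) -/

/-- For `L ≥ 1` the nearest-neighbour graph of `ℤ^d` is a subgraph of the range-`L` graph
(`‖eᵢ‖_∞ = 1 ≤ L`). [cite: Sakai2007, §1.2 (uniformly spread-out interaction)] -/
theorem zdGraph_le_spreadOutGraph (hL : 1 ≤ L) : zdGraph d ≤ spreadOutGraph d L := by
  intro x y hxy
  rw [spreadOutGraph_adj_iff]
  refine ⟨(zdGraph d).ne_of_adj hxy, fun i => ?_⟩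
  have hL' : (1 : ℤ) ≤ L := by exact_mod_cast hL
  obtain ⟨j, rfl | rfl⟩ := (zdGraph_adj_iff x y).1 hxy
  · by_cases hij : i = j
    · subst hij; simpa using hL'
    · simp [hij]
  · by_cases hij : i = j
    · subst hij; simpa using hL'
    · simp [hij]

/-- **GKS comparison**: for `L ≥ 1` and `β ≥ 0` the free-state two-point function of the
nearest-neighbour model is dominated by that of the spread-out model,
`⟨σ₀σ_x⟩^∅_β(n.n.) ≤ G_β(x)` (Griffiths' second inequality: adding ferromagnetic couplings
increases correlations, Friedli–Velenik 2017, Exercise 3.31; then the two monotone box limits).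
[cite: FriedliVelenik2017, Exercise 3.31] -/
theorem twoPointFree_le_spreadOutTwoPoint (hL : 1 ≤ L) {β : ℝ} (hβ : 0 ≤ β) (x : Site d) :
    twoPointFree d β x ≤ spreadOutTwoPoint d L β x := by
  have hlim := tendsto_isingTwoPoint_free (d := d) hasBoxLimit_isingCorr_free_holds hβ x
  refine le_of_tendsto hlim ?_
  filter_upwards [eventually_ge_atTop (Site.supNorm x)] with n hn
  have hx : x ∈ box d n := mem_box_iff_supNorm_le.2 hn
  refine le_trans ?_ (boxTwoPoint_le_spreadOutTwoPoint β n x)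
  by_cases hx0 : x = 0
  · subst hx0; simp [boxTwoPoint]
  · rw [boxTwoPoint, isingTwoPoint_eq_isingCorr _ _ _ _ _ (Ne.symm hx0),
      isingTwoPoint_eq_isingCorr _ _ _ _ _ (Ne.symm hx0)]
    refine isingCorr_free_mono_graph
      (fun Λ A B β h bc => Literature.Probability.LatticeModels.GKSInequalities.gks_two_holds _)
      (zdGraph_le_spreadOutGraph hL) hβ le_rfl ?_
    exact Finset.insert_subset_iff.2 ⟨zero_mem_box d n, Finset.singleton_subset_iff.2 hx⟩

/-- **Low temperature (discharge of `exists_forall_le_susceptibility_eq_top`, quantitative form).**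
For `d ≥ 2`, `L ≥ 1` and `β ≥ β_c(ℤ^d)` (the nearest-neighbour critical point) the spread-out
susceptibility is infinite: `χ_β ≥ χ^{n.n.}_β = ∞` (GKS comparison and the tree's
`susceptibility_eq_top_of_criticalBeta_le`, i.e. Peierls' long-range order plus the mean-field
bound). [cite: Sakai2007, §1.1 (χ_p = ∞ for p > p_c)] [cite: Peierls1936] -/
theorem spreadOutSusceptibility_eq_top_of_criticalBeta_le (hd : 2 ≤ d) (hL : 1 ≤ L) {β : ℝ}
    (hβ : criticalBeta d ≤ β) : spreadOutSusceptibility d L β = ∞ := by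
  have hβ0 : 0 ≤ β := (criticalBeta_nonneg d).trans hβ
  have hnn : Literature.Probability.LatticeModels.susceptibility d β = ⊤ :=
    susceptibility_eq_top_of_criticalBeta_le hd hβ
  refine eq_top_iff.2 ?_
  calc (⊤ : ℝ≥0∞) = Literature.Probability.LatticeModels.susceptibility d β := hnn.symm
    _ ≤ spreadOutSusceptibility d L β := ENNReal.tsum_le_tsum fun x =>
        ENNReal.ofReal_le_ofReal (twoPointFree_le_spreadOutTwoPoint hL hβ0 x)

/-- **Discharge of the named fact `exists_forall_le_susceptibility_eq_top`** (`d ≥ 2`, `L ≥ 1`: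
`χ_β = ∞` for all `β ≥ β₁`, with `β₁ = β_c(ℤ^d)`). [cite: Sakai2007, §1.1 (p_c < ∞)] -/
theorem exists_forall_le_susceptibility_eq_top_holds : exists_forall_le_susceptibility_eq_top :=
  fun d _ hd hL => ⟨criticalBeta d, fun _ hβ =>
    spreadOutSusceptibility_eq_top_of_criticalBeta_le hd hL hβ⟩


/-! ### Finite-volume susceptibilities of the spread-out model -/

/-- Neighbours of a site of `Λ_m` lie in `Λ_{m+L}` (finite range `L`). [folklore] -/
theorem mem_box_add_of_adj {m : ℕ} {x y : Site d} (hx : x ∈ box d m)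
    (hxy : (spreadOutGraph d L).Adj x y) : y ∈ box d (m + L) := by
  rw [spreadOutGraph_adj_iff] at hxy
  rw [mem_box] at hx ⊢
  intro i
  have h1 := hx i
  have h2 := hxy.2 i
  rw [abs_le] at h2
  push_cast
  constructor <;> linarith [h2.1, h2.2, h1.1, h1.2]

/-- The neighbourhood of `x + v` is the translate by `v` of the neighbourhood of `x` (translation
invariance of the range-`L` graph). [folklore] -/
theorem neighborFinset_add_eq_map (x v : Site d) :
    (spreadOutGraph d L).neighborFinset (x + v) =
      ((spreadOutGraph d L).neighborFinset x).map (Site.shift v).toEmbedding := by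
  ext y
  rw [SimpleGraph.mem_neighborFinset, mem_map_shift_iff', SimpleGraph.mem_neighborFinset,
    spreadOutGraph_adj_iff_sub _ _ (x + v) y, spreadOutGraph_adj_iff_sub _ _ x (y - v),
    show y - (x + v) = y - v - x by abel]

/-- `0 ≤ S_v^{Λ}(β) = Σ_{z ∈ Λ} ⟨σ_vσ_z⟩^∅_{Λ;β}` for `v ∈ Λ`, `β ≥ 0` (termwise GKS I). [folklore] -/
theorem volumeSusceptibility_nonneg {β : ℝ} (hβ : 0 ≤ β) {Λ : Finset (Site d)} {v : Site d}
    (hv : v ∈ Λ) : 0 ≤ volumeSusceptibility (spreadOutGraph d L) Λ β v :=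
  Finset.sum_nonneg fun _ hz => isingTwoPoint_free_nonneg _ hβ hv hz

/-- Duminil-Copin–Tassion's finite-volume functional for the spread-out graph,
`φ_β(S) = tanh β · Σ_{x ∈ S} #{y ∼ x : y ∉ S} · ⟨σ₀σ_x⟩^∅_{S;β,0}` (coupling `1` on the pairs
`0 < ‖x - y‖_∞ ≤ L`, so `tanh(βJ_{xy}) = tanh β`), the quantity whose smallness propagates through
the modified Simon inequality. Meaningful for `0 ∈ S` (every lemma below assumes it); for `0 ∉ S`
the value is junk (the finite-volume two-point function from a site outside the volume).
[cite: DuminilCopinTassionCMP2016, §2.1, eq. (2.1)] -/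
def soPhi (d L : ℕ) (β : ℝ) (S : Finset (Site d)) : ℝ :=
  Real.tanh β * ∑ x ∈ S,
    ((((spreadOutGraph d L).neighborFinset x).filter fun y => y ∉ S).card : ℝ) *
      isingTwoPoint (spreadOutGraph d L) S β 0 .free 0 x

/-- `φ_β(S) ≥ 0` for `β ≥ 0` when `0 ∈ S`. [cite: DuminilCopinTassionCMP2016, §2.1] -/
theorem soPhi_nonneg {β : ℝ} (hβ : 0 ≤ β) {S : Finset (Site d)} (h0 : (0 : Site d) ∈ S) :
    0 ≤ soPhi d L β S :=
  mul_nonneg (tanh_nonneg hβ) (Finset.sum_nonneg fun _ hx =>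
    mul_nonneg (Nat.cast_nonneg _) (isingTwoPoint_free_nonneg _ hβ h0 hx))

/-- **The boundary functional of a translated, truncated set is dominated by `φ_β(S)/tanh β`.**
For `β ≥ 0`, `0 ∈ S`, a finite volume `Λ ∋ a`, `T = S + a` and `S' = T ∩ Λ`:
`Σ_{x ∈ S'} #{y ∈ Λ ∖ S' : y ∼ x} ⟨σ_aσ_x⟩^∅_{S';β} ≤ Σ_{x ∈ S} #{y ∼ x : y ∉ S} ⟨σ₀σ_x⟩^∅_{S;β}`
(termwise: volume monotonicity `S' ⊆ T` and `{y ∈ Λ ∖ S' : y ∼ x} ⊆ {y ∼ x : y ∉ T}`; then the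
nonnegative terms indexed by `T ∖ S'` are added and the sum over `T` is translated back to `S`).
The common core of the susceptibility bound and of the decay iteration below.
[cite: DuminilCopinTassionCMP2016, §2.5 (arXiv:1502.03050 numbering)] -/
theorem boundary_sum_inter_le {β : ℝ} (hβ : 0 ≤ β) {S : Finset (Site d)} (h0 : (0 : Site d) ∈ S)
    {Λ : Finset (Site d)} {a : Site d} (ha : a ∈ Λ) :
    ∑ x ∈ S.map (Site.shift a).toEmbedding ∩ Λ,
        (((Λ \ (S.map (Site.shift a).toEmbedding ∩ Λ)).filter
            ((spreadOutGraph d L).Adj x)).card : ℝ) *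
          isingTwoPoint (spreadOutGraph d L) (S.map (Site.shift a).toEmbedding ∩ Λ) β 0 .free a x ≤
      ∑ x ∈ S, ((((spreadOutGraph d L).neighborFinset x).filter fun y => y ∉ S).card : ℝ) *
        isingTwoPoint (spreadOutGraph d L) S β 0 .free 0 x := by
  classical
  set φ := (Site.shift a).toEmbedding with hφ
  set T : Finset (Site d) := S.map φ with hT
  set S' : Finset (Site d) := T ∩ Λ with hS'
  have hφ0 : φ 0 = a := by simp [hφ]
  have haT : a ∈ T := by rw [hT, mem_map_shift_iff', sub_self]; exact h0
  have haS' : a ∈ S' := Finset.mem_inter.2 ⟨haT, ha⟩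
  have hS'T : S' ⊆ T := Finset.inter_subset_left
  -- termwise domination on `S'`, then extension of the index set to `T`, then translation
  set g : Site d → ℝ := fun x =>
    ((((spreadOutGraph d L).neighborFinset x).filter fun y => y ∉ T).card : ℝ) *
      isingTwoPoint (spreadOutGraph d L) T β 0 .free a x with hg
  have hg0 : ∀ x ∈ T, 0 ≤ g x := fun x hx =>
    mul_nonneg (Nat.cast_nonneg _) (isingTwoPoint_free_nonneg _ hβ haT hx)
  have hdom : ∀ x ∈ S', (((Λ \ S').filter ((spreadOutGraph d L).Adj x)).card : ℝ) *
      isingTwoPoint (spreadOutGraph d L) S' β 0 .free a x ≤ g x := by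
    intro x hx
    have hsub : (Λ \ S').filter ((spreadOutGraph d L).Adj x) ⊆
        ((spreadOutGraph d L).neighborFinset x).filter fun y => y ∉ T := by
      intro y hy
      have hy' := Finset.mem_filter.1 hy
      have hyΛS := Finset.mem_sdiff.1 hy'.1
      refine Finset.mem_filter.2 ⟨(SimpleGraph.mem_neighborFinset _ _ _).2 hy'.2, fun hyT => ?_⟩
      exact hyΛS.2 (Finset.mem_inter.2 ⟨hyT, hyΛS.1⟩)
    have hcard : (((Λ \ S').filter ((spreadOutGraph d L).Adj x)).card : ℝ) ≤
        ((((spreadOutGraph d L).neighborFinset x).filter fun y => y ∉ T).card : ℝ) := by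
      exact_mod_cast Finset.card_le_card hsub
    exact mul_le_mul hcard (isingTwoPoint_free_le_of_subset _ hβ haS' hx hS'T)
      (isingTwoPoint_free_nonneg _ hβ haS' hx) (Nat.cast_nonneg _)
  have htrans : ∑ x ∈ T, g x = ∑ x ∈ S,
      ((((spreadOutGraph d L).neighborFinset x).filter fun y => y ∉ S).card : ℝ) *
        isingTwoPoint (spreadOutGraph d L) S β 0 .free 0 x := by
    rw [hT, Finset.sum_map]
    refine Finset.sum_congr rfl fun x _ => ?_
    simp only [hg]
    congr 1
    · -- cardinalities: translate the neighbourhood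
      have hφx : φ x = x + a := by simp [hφ]
      rw [hφx, neighborFinset_add_eq_map, Finset.filter_map, Finset.card_map]
      congr 2
      ext y
      simp only [Finset.mem_filter, and_congr_right_iff, Function.comp_apply]
      intro _
      exact (Finset.mem_map' φ).not
    · -- two-point functions: transport by the translation
      have hmap := isingTwoPoint_free_map (G := spreadOutGraph d L) (G' := spreadOutGraph d L) φ
        (Λ := S) (fun p _ q _ => spreadOutGraph_adj_shift_iff d L a p q) β 0 0 x
      rw [hφ0] at hmap
      exact hmap
  calc ∑ x ∈ S', (((Λ \ S').filter ((spreadOutGraph d L).Adj x)).card : ℝ) *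
        isingTwoPoint (spreadOutGraph d L) S' β 0 .free a x
      ≤ ∑ x ∈ S', g x := Finset.sum_le_sum hdom
    _ ≤ ∑ x ∈ T, g x := Finset.sum_le_sum_of_subset_of_nonneg hS'T fun x hx _ => hg0 x hx
    _ = _ := htrans

/-- **The modified Simon inequality, summed: `S_v^{Λ} ≤ |S| + φ_β(S) · max_y S_y^{Λ}`.** For
`β ≥ 0`, a finite `S ∋ 0`, a box `Λ = Λ_n ∋ v` and any bound `M` on the finite-volume
susceptibilities `S_y^{Λ}(β)`, `y ∈ Λ`: the sites of `Λ ∩ (S + v)` contribute at most `|S|`, and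
for `z ∈ Λ ∖ (S + v)` the modified Simon inequality in the volume `(S + v) ∩ Λ`
(`isingTwoPoint_free_le_modifiedSimon`), volume monotonicity `(S+v) ∩ Λ ⊆ S + v` and translation
by `v` bound `Σ_z ⟨σ_vσ_z⟩_Λ` by `φ_β(S) · M` (Duminil-Copin–Tassion 2016, proof of Thm. 1.2,
first display of §3.2, in finite volume). [cite: DuminilCopinTassionCMP2016, Lemma 2.7 and §2.5, display (χ_n(β) ≤ |S| + φ_β(S)χ_n(β)) (arXiv:1502.03050 numbering)] -/
theorem volumeSusceptibility_le_card_add {β : ℝ} (hβ : 0 ≤ β) {S : Finset (Site d)}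
    (h0 : (0 : Site d) ∈ S) {n : ℕ} {v : Site d} (hv : v ∈ box d n) {M : ℝ}
    (hM : ∀ y ∈ box d n, volumeSusceptibility (spreadOutGraph d L) (box d n) β y ≤ M) :
    volumeSusceptibility (spreadOutGraph d L) (box d n) β v ≤ S.card + soPhi d L β S * M := by
  classical
  set Λ := box d n with hΛ
  set φ := (Site.shift v).toEmbedding with hφ
  set T : Finset (Site d) := S.map φ with hT
  set S' : Finset (Site d) := T ∩ Λ with hS'
  have hvT : v ∈ T := by rw [hT, mem_map_shift_iff', sub_self]; exact h0
  have hvS' : v ∈ S' := Finset.mem_inter.2 ⟨hvT, hv⟩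
  have hS'Λ : S' ⊆ Λ := Finset.inter_subset_right
  have hS'T : S' ⊆ T := Finset.inter_subset_left
  have htanh : 0 ≤ Real.tanh β := tanh_nonneg hβ
  have hM0 : 0 ≤ M := (volumeSusceptibility_nonneg hβ hv).trans (hM v hv)
  -- split the sum over `z ∈ Λ` according to `z ∈ T`
  have hsplit : volumeSusceptibility (spreadOutGraph d L) Λ β v =
      ∑ z ∈ Λ.filter (fun z => z ∈ T), isingTwoPoint (spreadOutGraph d L) Λ β 0 .free v z +
        ∑ z ∈ Λ.filter (fun z => z ∉ T), isingTwoPoint (spreadOutGraph d L) Λ β 0 .free v z := by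
    rw [volumeSusceptibility, Finset.sum_filter_add_sum_filter_not]
  -- part 1: at most `|S|` terms, each `≤ 1`
  have hpart1 : ∑ z ∈ Λ.filter (fun z => z ∈ T), isingTwoPoint (spreadOutGraph d L) Λ β 0 .free v z
      ≤ S.card := by
    calc ∑ z ∈ Λ.filter (fun z => z ∈ T), isingTwoPoint (spreadOutGraph d L) Λ β 0 .free v z
        ≤ ∑ _z ∈ Λ.filter (fun z => z ∈ T), (1 : ℝ) := Finset.sum_le_sum fun z _ =>
          (le_abs_self _).trans (abs_isingTwoPoint_le_one _ _ _ _ _ _ _)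
      _ = ((Λ.filter fun z => z ∈ T).card : ℝ) := by simp
      _ ≤ (T.card : ℝ) := by
          exact_mod_cast Finset.card_le_card fun z hz => (Finset.mem_filter.1 hz).2
      _ = S.card := by rw [hT, Finset.card_map]
  -- part 2: the modified Simon inequality for each `z ∉ T`, summed over `z`
  have hpart2 : ∑ z ∈ Λ.filter (fun z => z ∉ T), isingTwoPoint (spreadOutGraph d L) Λ β 0 .free v z
      ≤ soPhi d L β S * M := by
    -- pointwise modified Simon
    have hms : ∀ z ∈ Λ.filter (fun z => z ∉ T),
        isingTwoPoint (spreadOutGraph d L) Λ β 0 .free v z ≤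
          ∑ x ∈ S', ∑ y ∈ (Λ \ S').filter ((spreadOutGraph d L).Adj x),
            Real.tanh β * isingTwoPoint (spreadOutGraph d L) S' β 0 .free v x *
              isingTwoPoint (spreadOutGraph d L) Λ β 0 .free y z := by
      intro z hz
      have hz' := Finset.mem_filter.1 hz
      exact isingTwoPoint_free_le_modifiedSimon (spreadOutGraph d L) hβ hS'Λ hvS' hz'.1
        (fun h => hz'.2 (hS'T h))
    -- sum over `z`, exchange, and bound `Σ_z ⟨σ_yσ_z⟩ ≤ S_y ≤ M`
    have hstep : ∑ z ∈ Λ.filter (fun z => z ∉ T), isingTwoPoint (spreadOutGraph d L) Λ β 0 .free v z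
        ≤ ∑ x ∈ S', ∑ y ∈ (Λ \ S').filter ((spreadOutGraph d L).Adj x),
            Real.tanh β * isingTwoPoint (spreadOutGraph d L) S' β 0 .free v x * M := by
      calc ∑ z ∈ Λ.filter (fun z => z ∉ T), isingTwoPoint (spreadOutGraph d L) Λ β 0 .free v z
          ≤ ∑ z ∈ Λ.filter (fun z => z ∉ T), ∑ x ∈ S', ∑ y ∈ (Λ \ S').filter ((spreadOutGraph d L).Adj x),
              Real.tanh β * isingTwoPoint (spreadOutGraph d L) S' β 0 .free v x *
                isingTwoPoint (spreadOutGraph d L) Λ β 0 .free y z := Finset.sum_le_sum hms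
        _ = ∑ x ∈ S', ∑ y ∈ (Λ \ S').filter ((spreadOutGraph d L).Adj x),
              Real.tanh β * isingTwoPoint (spreadOutGraph d L) S' β 0 .free v x *
                ∑ z ∈ Λ.filter (fun z => z ∉ T), isingTwoPoint (spreadOutGraph d L) Λ β 0 .free y z := by
            rw [Finset.sum_comm]
            refine Finset.sum_congr rfl fun x _ => ?_
            rw [Finset.sum_comm]
            refine Finset.sum_congr rfl fun y _ => ?_
            rw [Finset.mul_sum]
        _ ≤ ∑ x ∈ S', ∑ y ∈ (Λ \ S').filter ((spreadOutGraph d L).Adj x),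
              Real.tanh β * isingTwoPoint (spreadOutGraph d L) S' β 0 .free v x * M := by
            refine Finset.sum_le_sum fun x hx => Finset.sum_le_sum fun y hy => ?_
            have hyΛ : y ∈ Λ := (Finset.mem_sdiff.1 (Finset.mem_filter.1 hy).1).1
            have hcoef : 0 ≤ Real.tanh β * isingTwoPoint (spreadOutGraph d L) S' β 0 .free v x :=
              mul_nonneg htanh (isingTwoPoint_free_nonneg _ hβ hvS' hx)
            refine mul_le_mul_of_nonneg_left ?_ hcoef
            calc ∑ z ∈ Λ.filter (fun z => z ∉ T), isingTwoPoint (spreadOutGraph d L) Λ β 0 .free y z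
                ≤ volumeSusceptibility (spreadOutGraph d L) Λ β y :=
                  Finset.sum_le_sum_of_subset_of_nonneg (Finset.filter_subset _ _)
                    fun z hz _ => isingTwoPoint_free_nonneg _ hβ hyΛ hz
              _ ≤ M := hM y hyΛ
    -- compare the boundary functional in `S' ⊆ T = S + v` with `φ_β(S)`
    have hbdry : ∑ x ∈ S', ∑ y ∈ (Λ \ S').filter ((spreadOutGraph d L).Adj x),
        Real.tanh β * isingTwoPoint (spreadOutGraph d L) S' β 0 .free v x * M ≤ soPhi d L β S * M := by
      -- rewrite the left side with cardinalities
      have hL1 : ∑ x ∈ S', ∑ y ∈ (Λ \ S').filter ((spreadOutGraph d L).Adj x),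
          Real.tanh β * isingTwoPoint (spreadOutGraph d L) S' β 0 .free v x * M =
          (Real.tanh β * ∑ x ∈ S', ((((Λ \ S').filter ((spreadOutGraph d L).Adj x)).card : ℝ) *
            isingTwoPoint (spreadOutGraph d L) S' β 0 .free v x)) * M := by
        rw [Finset.mul_sum, Finset.sum_mul]
        refine Finset.sum_congr rfl fun x _ => ?_
        rw [Finset.sum_const, nsmul_eq_mul]
        ring
      rw [hL1]
      refine mul_le_mul_of_nonneg_right ?_ hM0
      exact mul_le_mul_of_nonneg_left (boundary_sum_inter_le hβ h0 hv) htanh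
    exact hstep.trans hbdry
  rw [hsplit]
  exact add_le_add hpart1 hpart2


/-- **The finite-size criterion in finite volume**: if `φ_β(S) < 1` (`β ≥ 0`, `0 ∈ S`), then in
every box `S_v^{Λ_n}(β) ≤ |S| / (1 - φ_β(S))` for all `v ∈ Λ_n` (apply
`volumeSusceptibility_le_card_add` with `M = max_y S_y^{Λ_n}` and solve for the maximum).
[cite: DuminilCopinTassionCMP2016, §2.5 (proof of the second item of Thm. 2.1) (arXiv:1502.03050 numbering)] -/
theorem volumeSusceptibility_le_of_soPhi_lt_one {β : ℝ} (hβ : 0 ≤ β) {S : Finset (Site d)}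
    (h0 : (0 : Site d) ∈ S) (hφ : soPhi d L β S < 1) {n : ℕ} {v : Site d} (hv : v ∈ box d n) :
    volumeSusceptibility (spreadOutGraph d L) (box d n) β v ≤ S.card / (1 - soPhi d L β S) := by
  have hne : (box d n).Nonempty := ⟨0, zero_mem_box d n⟩
  set M := (box d n).sup' hne (fun y => volumeSusceptibility (spreadOutGraph d L) (box d n) β y)
    with hM
  have hle : ∀ y ∈ box d n, volumeSusceptibility (spreadOutGraph d L) (box d n) β y ≤ M :=
    fun y hy => Finset.le_sup' (fun y => volumeSusceptibility (spreadOutGraph d L) (box d n) β y) hy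
  have hMbound : M ≤ S.card + soPhi d L β S * M :=
    Finset.sup'_le hne _ fun y hy => volumeSusceptibility_le_card_add hβ h0 hy hle
  have h1 : 0 < 1 - soPhi d L β S := sub_pos.2 hφ
  have hM' : M ≤ S.card / (1 - soPhi d L β S) := by
    rw [le_div_iff₀ h1]
    have : M * (1 - soPhi d L β S) = M - soPhi d L β S * M := by ring
    linarith
  exact (hle v hv).trans hM'

/-- `S_0^{Λ_n}(β) ≤ χ_β` in `[0, ∞]` for `β ≥ 0` (termwise `⟨σ₀σ_y⟩_{Λ_n;β} ≤ G_β(y)`, and a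
finite partial sum is below the series). [cite: Sakai2007, §1.1 (monotone infinite-volume limit, χ_p)] -/
theorem ofReal_volumeSusceptibility_le_spreadOutSusceptibility {β : ℝ} (hβ : 0 ≤ β) (n : ℕ) :
    ENNReal.ofReal (volumeSusceptibility (spreadOutGraph d L) (box d n) β 0) ≤
      spreadOutSusceptibility d L β := by
  have h1 : volumeSusceptibility (spreadOutGraph d L) (box d n) β 0 ≤
      ∑ y ∈ box d n, spreadOutTwoPoint d L β y :=
    Finset.sum_le_sum fun y _ => boxTwoPoint_le_spreadOutTwoPoint β n y
  calc ENNReal.ofReal (volumeSusceptibility (spreadOutGraph d L) (box d n) β 0)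
      ≤ ENNReal.ofReal (∑ y ∈ box d n, spreadOutTwoPoint d L β y) := ENNReal.ofReal_le_ofReal h1
    _ = ∑ y ∈ box d n, ENNReal.ofReal (spreadOutTwoPoint d L β y) :=
        ENNReal.ofReal_sum_of_nonneg fun y _ => spreadOutTwoPoint_nonneg hβ y
    _ ≤ spreadOutSusceptibility d L β := ENNReal.sum_le_tsum _

/-- `χ_β ≤ sup_n S_0^{Λ_n}(β)` for `β ≥ 0` (monotone convergence of the finite-volume two-point
functions: every partial sum `Σ_{y ∈ Λ_m} G_β(y)` is the limit of `Σ_{y ∈ Λ_m} ⟨σ₀σ_y⟩_{Λ_n;β}`,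
which is at most `S_0^{Λ_n}(β)` once `n ≥ m`). [cite: Sakai2007, §1.1 (monotone infinite-volume limit, χ_p)] -/
theorem spreadOutSusceptibility_le_iSup {β : ℝ} (hβ : 0 ≤ β) :
    spreadOutSusceptibility d L β ≤
      ⨆ n : ℕ, ENNReal.ofReal (volumeSusceptibility (spreadOutGraph d L) (box d n) β 0) := by
  rw [spreadOutSusceptibility,
    ENNReal.tsum_eq_iSup_sum' (box d) fun t => (eventually_subset_box' t).exists]
  refine iSup_le fun m => ?_
  have hG0 : ∀ y, 0 ≤ spreadOutTwoPoint d L β y := fun y => spreadOutTwoPoint_nonneg hβ y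
  rw [← ENNReal.ofReal_sum_of_nonneg fun y _ => hG0 y]
  have hconv : Tendsto (fun n : ℕ => ENNReal.ofReal (∑ y ∈ box d m, boxTwoPoint d L β n y)) atTop
      (𝓝 (ENNReal.ofReal (∑ y ∈ box d m, spreadOutTwoPoint d L β y))) :=
    (ENNReal.continuous_ofReal.tendsto _).comp
      (tendsto_finsetSum _ fun y _ => tendsto_boxTwoPoint hβ y)
  refine le_of_tendsto hconv ?_
  filter_upwards [eventually_ge_atTop m] with n hn
  refine le_trans (ENNReal.ofReal_le_ofReal ?_)
    (le_iSup (fun n : ℕ => ENNReal.ofReal (volumeSusceptibility (spreadOutGraph d L) (box d n) β 0)) n)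
  exact Finset.sum_le_sum_of_subset_of_nonneg (box_mono d hn) fun y _ _ => boxTwoPoint_nonneg hβ n y

/-- **The finite-size criterion** (Simon 1980, Lieb 1980; Duminil-Copin–Tassion 2016, Thm. 2.1,
second item, "For `β < β_c`, the susceptibility is finite", proved in §2.5 for every `β` admitting
a finite `S ∋ 0` with `φ_β(S) < 1`), for the spread-out Ising model and the free-boundary two-point
function `G_β`: if `φ_β(S) < 1` for some finite `S ∋ 0` and `β ≥ 0`, then
`χ_β ≤ |S| / (1 - φ_β(S)) < ∞`.
[cite: DuminilCopinTassionCMP2016, Thm. 2.1 (second item) and §2.5 (arXiv:1502.03050 numbering)] [cite: Simon1980] -/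
theorem spreadOutSusceptibility_le_of_soPhi_lt_one {β : ℝ} (hβ : 0 ≤ β) {S : Finset (Site d)}
    (h0 : (0 : Site d) ∈ S) (hφ : soPhi d L β S < 1) :
    spreadOutSusceptibility d L β ≤ ENNReal.ofReal (S.card / (1 - soPhi d L β S)) :=
  (spreadOutSusceptibility_le_iSup hβ).trans (iSup_le fun n =>
    ENNReal.ofReal_le_ofReal (volumeSusceptibility_le_of_soPhi_lt_one hβ h0 hφ (zero_mem_box d n)))

/-! ### High temperature: discharge of `exists_pos_susceptibility_lt_top` -/

/-- `φ_β({0}) ≤ |J| tanh β` with `|J| = deg 0 = (2L+1)^d - 1`. [cite: DuminilCopinTassionCMP2016, §2.1] -/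
theorem soPhi_singleton_le {β : ℝ} (hβ : 0 ≤ β) :
    soPhi d L β {0} ≤ Real.tanh β * (spreadOutGraph d L).degree 0 := by
  unfold soPhi
  rw [Finset.sum_singleton, isingTwoPoint_self, mul_one]
  refine mul_le_mul_of_nonneg_left ?_ (tanh_nonneg hβ)
  exact_mod_cast (Finset.card_filter_le _ _).trans
    (SimpleGraph.card_neighborFinset_eq_degree _ _).le

/-- **Discharge of the named fact `exists_pos_susceptibility_lt_top`** (high temperature): for
every `d`, `L` there is `β > 0` with `χ_β < ∞` — any `β > 0` with `|J| tanh β < 1`, by the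
finite-size criterion with `S = {0}` (`χ_β ≤ (1 - |J| tanh β)⁻¹`).
[cite: Sakai2007, §1.1 (p_c > 0, χ_p < ∞ for p < p_c)] [cite: DuminilCopinTassionCMP2016, Thm. 2.1 (second item) and §2.5] -/
theorem exists_pos_susceptibility_lt_top_holds : exists_pos_susceptibility_lt_top := by
  intro d L _ _
  set D : ℝ := ((spreadOutGraph d L).degree 0 : ℝ) with hD
  have hD0 : 0 ≤ D := Nat.cast_nonneg _
  have h0 : Real.tanh 0 < 1 / (D + 1) := by rw [Real.tanh_zero]; positivity
  have htanh : Continuous Real.tanh := by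
    rw [show Real.tanh = fun x => Real.sinh x / Real.cosh x from funext Real.tanh_eq_sinh_div_cosh]
    exact Real.continuous_sinh.div Real.continuous_cosh fun x => (Real.cosh_pos x).ne'
  have hev : ∀ᶠ β in 𝓝 (0 : ℝ), Real.tanh β < 1 / (D + 1) :=
    (htanh.tendsto 0).eventually_lt_const h0
  have hev' : ∀ᶠ β in 𝓝[>] (0 : ℝ), Real.tanh β < 1 / (D + 1) ∧ β ∈ Set.Ioi (0 : ℝ) :=
    (hev.filter_mono nhdsWithin_le_nhds).and eventually_mem_nhdsWithin
  obtain ⟨β, hβt, hβpos⟩ := hev'.exists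
  rw [Set.mem_Ioi] at hβpos
  refine ⟨β, hβpos, ?_⟩
  have hφ : soPhi d L β {0} < 1 :=
    calc soPhi d L β {0} ≤ Real.tanh β * D := soPhi_singleton_le hβpos.le
      _ ≤ 1 / (D + 1) * D := mul_le_mul_of_nonneg_right hβt.le hD0
      _ < 1 := by
          rw [div_mul_eq_mul_div, one_mul, div_lt_one (by positivity)]
          exact lt_add_one D
  exact (spreadOutSusceptibility_le_of_soPhi_lt_one hβpos.le (Finset.mem_singleton_self 0)
    hφ).trans_lt ENNReal.ofReal_lt_top

/-! ### Divergence at `β_c`: discharge of `susceptibility_unbounded_below_critBeta` -/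

/-- Continuity in `β` of the finite-volume functional `φ_β(S)`. [cite: DuminilCopinTassionCMP2016, §2.1] -/
theorem continuous_soPhi (S : Finset (Site d)) : Continuous fun β => soPhi d L β S := by
  have htanh : Continuous Real.tanh := by
    rw [show Real.tanh = fun x => Real.sinh x / Real.cosh x from funext Real.tanh_eq_sinh_div_cosh]
    exact Real.continuous_sinh.div Real.continuous_cosh fun x => (Real.cosh_pos x).ne'
  exact htanh.mul (continuous_finsetSum _ fun x _ => continuous_const.mul
    (continuous_isingExpect (spreadOutGraph d L) S 0 .free (measurable_spinPair 0 x)))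

/-- **If `χ_β < ∞` then `φ_β(Λ_n) < 1` for some box** (`β ≥ 0`): the shell sums
`a_j = Σ_{‖x‖_∞ = j} G_β(x)` are summable, so the sums over `L` consecutive shells tend to `0`;
only the sites of `Λ_{k+L} ∖ Λ_k` have neighbours outside `Λ_{k+L}` (range `L`), at most `|J|` of
them, and `⟨σ₀σ_x⟩_{Λ;β} ≤ G_β(x)`, whence `φ_β(Λ_{k+L}) ≤ |J| tanh β · Σ_{k < j ≤ k+L} a_j → 0`.
(Contrapositive of the computation proving Duminil-Copin–Tassion 2016, Prop. 2.2 ([Sim80]):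
"`(Σ_y tanh(βJ_{0,y})) · Σ_x ⟨σ₀σ_x⟩ ≥ Σ_{n ≥ 1} φ_β(Λ_n)`", so a finite susceptibility forces
small `φ_β(Λ_n)`.) [cite: DuminilCopinTassionCMP2016, Prop. 2.2 and its proof (arXiv:1502.03050 numbering)] [cite: Simon1980] -/
theorem exists_soPhi_box_lt_one {β m : ℝ} (hβ : 0 ≤ β) (hm : 0 ≤ m)
    (hχ : spreadOutSusceptibility d L β ≤ ENNReal.ofReal m) :
    ∃ n : ℕ, soPhi d L β (box d n) < 1 := by
  -- shell sums of the infinite-volume two-point function and their summability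
  set a : ℕ → ℝ := fun j => ∑ x ∈ sphere d j, spreadOutTwoPoint d L β x with ha
  have hG0 : ∀ x, 0 ≤ spreadOutTwoPoint d L β x := fun x => spreadOutTwoPoint_nonneg hβ x
  have ha0 : ∀ j, 0 ≤ a j := fun j => Finset.sum_nonneg fun x _ => hG0 x
  have hbox : ∀ N : ℕ, ∑ x ∈ box d N, spreadOutTwoPoint d L β x ≤ m := by
    intro N
    have h1 : ENNReal.ofReal (∑ x ∈ box d N, spreadOutTwoPoint d L β x) ≤ ENNReal.ofReal m := by
      rw [ENNReal.ofReal_sum_of_nonneg fun x _ => hG0 x]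
      exact (ENNReal.sum_le_tsum _).trans hχ
    exact (ENNReal.ofReal_le_ofReal_iff hm).1 h1
  have hpartial : ∀ N : ℕ, ∑ j ∈ Finset.range N, a j ≤ m := by
    intro N
    calc ∑ j ∈ Finset.range N, a j ≤ ∑ j ∈ Finset.range (N + 1), a j :=
          Finset.sum_le_sum_of_subset_of_nonneg (Finset.range_mono (Nat.le_succ N))
            fun j _ _ => ha0 j
      _ = ∑ x ∈ box d N, spreadOutTwoPoint d L β x := (sum_box_eq_sum_range_sum_sphere N _).symm
      _ ≤ m := hbox N
  have hsum : Summable a := summable_of_sum_range_le ha0 hpartial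
  have hto : Tendsto a atTop (𝓝 0) := hsum.tendsto_atTop_zero
  -- sums over `L` consecutive shells
  set w : ℕ → ℝ := fun k => ∑ i ∈ Finset.range L, a (k + 1 + i) with hw
  have hw0 : ∀ k, 0 ≤ w k := fun k => Finset.sum_nonneg fun i _ => ha0 _
  have hwto : Tendsto w atTop (𝓝 0) := by
    have h : Tendsto w atTop (𝓝 (∑ _i ∈ Finset.range L, (0 : ℝ))) := by
      refine tendsto_finsetSum _ fun i _ => ?_
      have hfun : (fun k : ℕ => a (k + 1 + i)) = a ∘ fun k : ℕ => k + (1 + i) := by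
        funext k; simp [add_assoc]
      rw [hfun]
      exact hto.comp (tendsto_add_atTop_nat (1 + i))
    simpa using h
  -- the constant `c = |J| tanh β`
  set D : ℝ := ((spreadOutGraph d L).degree 0 : ℝ) with hD
  have hD0 : 0 ≤ D := Nat.cast_nonneg _
  set c : ℝ := D * Real.tanh β with hc
  have hc0 : 0 ≤ c := mul_nonneg hD0 (tanh_nonneg hβ)
  have hev : ∀ᶠ k in atTop, w k < 1 / (c + 1) :=
    hwto.eventually_lt_const (one_div_pos.2 (by linarith))
  obtain ⟨k, hk⟩ := hev.exists
  refine ⟨k + L, ?_⟩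
  -- `φ_β(Λ_{k+L}) ≤ c · w k`
  have hterm : ∀ x ∈ box d (k + L),
      ((((spreadOutGraph d L).neighborFinset x).filter fun y => y ∉ box d (k + L)).card : ℝ) *
          isingTwoPoint (spreadOutGraph d L) (box d (k + L)) β 0 .free 0 x ≤
        D * (if x ∈ box d k then 0 else spreadOutTwoPoint d L β x) := by
    intro x hx
    by_cases hxk : x ∈ box d k
    · have hempty : (((spreadOutGraph d L).neighborFinset x).filter fun y => y ∉ box d (k + L)) = ∅ := by
        rw [Finset.filter_eq_empty_iff]
        intro y hy hyn
        exact hyn (mem_box_add_of_adj hxk ((SimpleGraph.mem_neighborFinset _ _ _).1 hy))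
      rw [hempty, if_pos hxk]
      simp
    · rw [if_neg hxk]
      refine mul_le_mul ?_ (boxTwoPoint_le_spreadOutTwoPoint β (k + L) x)
        (isingTwoPoint_free_nonneg _ hβ (zero_mem_box d _) hx) hD0
      calc ((((spreadOutGraph d L).neighborFinset x).filter fun y => y ∉ box d (k + L)).card : ℝ)
          ≤ (((spreadOutGraph d L).neighborFinset x).card : ℝ) := by
            exact_mod_cast Finset.card_filter_le _ _
        _ = D := by rw [hD, card_neighborFinset_spreadOutGraph]
  have hshell : ∀ j, ∑ x ∈ sphere d j, (if x ∈ box d k then (0 : ℝ) else spreadOutTwoPoint d L β x) =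
      if j ≤ k then 0 else a j := by
    intro j
    by_cases hj : j ≤ k
    · rw [if_pos hj]
      refine Finset.sum_eq_zero fun x hx => ?_
      rw [if_pos (mem_box_iff_supNorm_le.2 ((mem_sphere.1 hx).le.trans hj))]
    · rw [if_neg hj]
      refine Finset.sum_congr rfl fun x hx => ?_
      rw [if_neg]
      rw [mem_box_iff_supNorm_le, mem_sphere.1 hx]
      exact hj
  have hsumeq : ∑ x ∈ box d (k + L), (if x ∈ box d k then (0 : ℝ) else spreadOutTwoPoint d L β x)
      = w k := by
    rw [sum_box_eq_sum_range_sum_sphere]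
    simp only [hshell]
    rw [← Finset.sum_range_add_sum_Ico _ (show k + 1 ≤ k + L + 1 by omega),
      Finset.sum_eq_zero fun j hj => if_pos (Nat.le_of_lt_succ (Finset.mem_range.1 hj)), zero_add,
      Finset.sum_Ico_eq_sum_range, show k + L + 1 - (k + 1) = L by omega]
    refine Finset.sum_congr rfl fun i _ => ?_
    rw [if_neg (by omega)]
  have hφle : soPhi d L β (box d (k + L)) ≤ c * w k := by
    unfold soPhi
    calc Real.tanh β * ∑ x ∈ box d (k + L),
          ((((spreadOutGraph d L).neighborFinset x).filter fun y => y ∉ box d (k + L)).card : ℝ) *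
            isingTwoPoint (spreadOutGraph d L) (box d (k + L)) β 0 .free 0 x
        ≤ Real.tanh β * ∑ x ∈ box d (k + L),
            D * (if x ∈ box d k then 0 else spreadOutTwoPoint d L β x) :=
          mul_le_mul_of_nonneg_left (Finset.sum_le_sum hterm) (tanh_nonneg hβ)
      _ = Real.tanh β * (D * w k) := by rw [← Finset.mul_sum, hsumeq]
      _ = c * w k := by rw [hc]; ring
  calc soPhi d L β (box d (k + L)) ≤ c * w k := hφle
    _ ≤ (c + 1) * w k := mul_le_mul_of_nonneg_right (by linarith) (hw0 k)
    _ < (c + 1) * (1 / (c + 1)) := mul_lt_mul_of_pos_left hk (by linarith)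
    _ = 1 := by field_simp

/-- **The high-temperature regime `{β ≥ 0 : χ_β < ∞}` is open to the right** (Simon 1980 /
Lieb 1980; Duminil-Copin–Tassion 2016, §2.5 with Prop. 2.2): if `χ_β < ∞` (`β ≥ 0`) then
`χ_{β'} < ∞` for some `β' > β`. Indeed `φ_β(Λ_n) < 1` for some box (`exists_soPhi_box_lt_one`),
hence `φ_{β'}(Λ_n) < 1` for some `β' > β` by continuity of the finite-volume functional, and the
finite-size criterion applies at `β'`.
[cite: DuminilCopinTassionCMP2016, Prop. 2.2 and §2.5 (arXiv:1502.03050 numbering)] [cite: Simon1980] [cite: Lieb1980] -/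
theorem exists_gt_susceptibility_lt_top {β : ℝ} (hβ : 0 ≤ β)
    (hχ : spreadOutSusceptibility d L β < ∞) :
    ∃ β' : ℝ, β < β' ∧ spreadOutSusceptibility d L β' < ∞ := by
  set m : ℝ := (spreadOutSusceptibility d L β).toReal with hm
  have hm0 : 0 ≤ m := ENNReal.toReal_nonneg
  have hχm : spreadOutSusceptibility d L β ≤ ENNReal.ofReal m := (ENNReal.ofReal_toReal hχ.ne).ge
  obtain ⟨n, hn⟩ := exists_soPhi_box_lt_one hβ hm0 hχm
  have hev : ∀ᶠ β' in 𝓝 β, soPhi d L β' (box d n) < 1 :=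
    ((continuous_soPhi (d := d) (L := L) (box d n)).tendsto β).eventually_lt_const hn
  have hev' : ∀ᶠ β' in 𝓝[>] β, soPhi d L β' (box d n) < 1 ∧ β' ∈ Set.Ioi β :=
    (hev.filter_mono nhdsWithin_le_nhds).and eventually_mem_nhdsWithin
  obtain ⟨β', hφ', hβ'⟩ := hev'.exists
  rw [Set.mem_Ioi] at hβ'
  exact ⟨β', hβ', (spreadOutSusceptibility_le_of_soPhi_lt_one (hβ.trans hβ'.le) (zero_mem_box d n)
    hφ').trans_lt ENNReal.ofReal_lt_top⟩

/-- **`χ_{β_c} = ∞`** for the spread-out model, `d ≥ 2`, `L ≥ 1` (Simon 1980; Duminil-Copin–Tassion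
2016, Prop. 2.2: "`Σ_x ⟨σ₀σ_x⟩_{β_c} = ∞`"): `β_c = sup {β ≥ 0 : χ_β < ∞}` is a genuine supremum
(high and low temperature, above), and a finite `χ_{β_c}` would put some `β' > β_c` in that set
(`exists_gt_susceptibility_lt_top`).
[cite: DuminilCopinTassionCMP2016, Prop. 2.2 (arXiv:1502.03050 numbering)] [cite: Simon1980]
[cite: Sakai2007, §1.1 (χ_p diverges as p ↑ p_c)] -/
theorem spreadOutSusceptibility_critBeta_eq_top (hd : 2 ≤ d) (hL : 1 ≤ L) :
    spreadOutSusceptibility d L (critBeta d L) = ∞ := by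
  by_contra hne
  obtain ⟨β₀, hβ₀, hfin₀⟩ := exists_pos_susceptibility_lt_top_holds d L hd hL
  obtain ⟨β₁, hβ₁⟩ := exists_forall_le_susceptibility_eq_top_holds d L hd hL
  have hpos : 0 < critBeta d L := critBeta_pos_of hβ₁ hβ₀ hfin₀
  obtain ⟨β', hβ', hfin⟩ := exists_gt_susceptibility_lt_top hpos.le (lt_top_iff_ne_top.2 hne)
  exact absurd (le_critBeta_of_susceptibility_lt_top hβ₁ (hpos.le.trans hβ'.le) hfin) (not_le.2 hβ')

/-- **Discharge of the named fact `susceptibility_unbounded_below_critBeta`**: for `d ≥ 2`,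
`L ≥ 1` the susceptibility is unbounded on `[0, β_c)` ("The susceptibility `χ_p` is known to
diverge as `p ↑ p_c`", Sakai 2007, §1.1). Proof: if `χ < M < ∞` on `[0, β_c)`, then `χ_{β_c} ≤ M`
— each partial sum `Σ_{x ∈ F} G_{β_c}(x)` is the volume limit of the finite-volume sums
`Σ_{x ∈ F} ⟨σ₀σ_x⟩_{Λ_n;β_c}`, which are continuous in `β` and bounded by `M` from the left —
contradicting `χ_{β_c} = ∞` (`spreadOutSusceptibility_critBeta_eq_top`).
[cite: Sakai2007, §1.1 (χ_p diverges as p ↑ p_c)] [cite: DuminilCopinTassionCMP2016, Prop. 2.2 (arXiv:1502.03050 numbering)]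
[cite: Simon1980] -/
theorem susceptibility_unbounded_below_critBeta_holds : susceptibility_unbounded_below_critBeta := by
  intro d L hd hL M hM
  by_contra hcon
  push Not at hcon
  obtain ⟨β₀, hβ₀, hfin₀⟩ := exists_pos_susceptibility_lt_top_holds d L hd hL
  obtain ⟨β₁, hβ₁⟩ := exists_forall_le_susceptibility_eq_top_holds d L hd hL
  have hpos : 0 < critBeta d L := critBeta_pos_of hβ₁ hβ₀ hfin₀
  set βc := critBeta d L with hβc
  set m : ℝ := M.toReal with hm
  have hm0 : 0 ≤ m := ENNReal.toReal_nonneg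
  have hMm : M = ENNReal.ofReal m := (ENNReal.ofReal_toReal hM.ne).symm
  -- `χ_{β_c} ≤ M`
  have hχc : spreadOutSusceptibility d L βc ≤ ENNReal.ofReal m := by
    rw [spreadOutSusceptibility, ENNReal.tsum_eq_iSup_sum]
    refine iSup_le fun F => ?_
    rw [← ENNReal.ofReal_sum_of_nonneg fun x _ => spreadOutTwoPoint_nonneg hpos.le x]
    refine ENNReal.ofReal_le_ofReal ?_
    have hvol : Tendsto (fun n : ℕ => ∑ x ∈ F, boxTwoPoint d L βc n x) atTop
        (𝓝 (∑ x ∈ F, spreadOutTwoPoint d L βc x)) :=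
      tendsto_finsetSum _ fun x _ => tendsto_boxTwoPoint hpos.le x
    refine le_of_tendsto' hvol fun n => ?_
    have hcont : Tendsto (fun β => ∑ x ∈ F, boxTwoPoint d L β n x) (𝓝[<] βc)
        (𝓝 (∑ x ∈ F, boxTwoPoint d L βc n x)) :=
      ((continuous_finsetSum _ fun x _ => continuous_boxTwoPoint n x).tendsto βc).mono_left
        nhdsWithin_le_nhds
    refine le_of_tendsto hcont ?_
    filter_upwards [Ioo_mem_nhdsLT hpos] with β hβ
    have h1 : ∑ x ∈ F, boxTwoPoint d L β n x ≤ ∑ x ∈ F, spreadOutTwoPoint d L β x :=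
      Finset.sum_le_sum fun x _ => boxTwoPoint_le_spreadOutTwoPoint β n x
    have h2 : ENNReal.ofReal (∑ x ∈ F, spreadOutTwoPoint d L β x) ≤ ENNReal.ofReal m := by
      rw [ENNReal.ofReal_sum_of_nonneg fun x _ => spreadOutTwoPoint_nonneg hβ.1.le x, ← hMm]
      exact (ENNReal.sum_le_tsum _).trans (hcon β hβ.1.le hβ.2).le
    exact h1.trans ((ENNReal.ofReal_le_ofReal_iff hm0).1 h2)
  have htop := spreadOutSusceptibility_critBeta_eq_top (d := d) (L := L) hd hL
  rw [← hβc] at htop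
  exact absurd (hχc.trans_lt ENNReal.ofReal_lt_top) (by rw [htop]; exact lt_irrefl _)

/-! ### Exponential decay of `G_β` in the high-temperature regime (`χ_β < ∞`, in particular
`β < β_c`) -/

/-- **One step of the Duminil-Copin–Tassion iteration.** For `β ≥ 0`, `0 ∈ S`, a finite volume
`Λ`, `a, z ∈ Λ` with `z ∉ S + a`, and a bound `B ≥ 0` on `⟨σ_yσ_z⟩^∅_{Λ;β}` over the sites
`y ∈ Λ ∖ (S + a)` adjacent to `S + a`:  `⟨σ_aσ_z⟩^∅_{Λ;β} ≤ φ_β(S) · B` (modified Simon inequality in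
the volume `(S + a) ∩ Λ`, then `boundary_sum_inter_le`). The finite-volume form of "for any `z` …
`⟨σ₀σ_z⟩ ≤ φ_β(S) max_{y ∈ Λ_L} ⟨σ_yσ_z⟩`" (Duminil-Copin–Tassion 2016, §2.5, proof of the third
item of Thm. 2.1). [cite: DuminilCopinTassionCMP2016, Lemma 2.7 and §2.5 (proof of the third item of Thm. 2.1) (arXiv:1502.03050 numbering)] -/
theorem isingTwoPoint_le_soPhi_mul {β : ℝ} (hβ : 0 ≤ β) {S : Finset (Site d)}
    (h0 : (0 : Site d) ∈ S) {Λ : Finset (Site d)} {a z : Site d} (ha : a ∈ Λ) (hz : z ∈ Λ)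
    (hzS : z ∉ S.map (Site.shift a).toEmbedding) {B : ℝ} (hB0 : 0 ≤ B)
    (hB : ∀ y ∈ Λ, y ∉ S.map (Site.shift a).toEmbedding →
      (∃ x ∈ S.map (Site.shift a).toEmbedding, (spreadOutGraph d L).Adj x y) →
        isingTwoPoint (spreadOutGraph d L) Λ β 0 .free y z ≤ B) :
    isingTwoPoint (spreadOutGraph d L) Λ β 0 .free a z ≤ soPhi d L β S * B := by
  classical
  set T : Finset (Site d) := S.map (Site.shift a).toEmbedding with hT
  set S' : Finset (Site d) := T ∩ Λ with hS'
  have haT : a ∈ T := by rw [hT, mem_map_shift_iff', sub_self]; exact h0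
  have haS' : a ∈ S' := Finset.mem_inter.2 ⟨haT, ha⟩
  have hS'Λ : S' ⊆ Λ := Finset.inter_subset_right
  have hS'T : S' ⊆ T := Finset.inter_subset_left
  have hzS' : z ∉ S' := fun h => hzS (hS'T h)
  have htanh : 0 ≤ Real.tanh β := tanh_nonneg hβ
  refine (isingTwoPoint_free_le_modifiedSimon (spreadOutGraph d L) hβ hS'Λ haS' hz hzS').trans ?_
  calc ∑ x ∈ S', ∑ y ∈ (Λ \ S').filter ((spreadOutGraph d L).Adj x),
        Real.tanh β * isingTwoPoint (spreadOutGraph d L) S' β 0 .free a x *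
          isingTwoPoint (spreadOutGraph d L) Λ β 0 .free y z
      ≤ ∑ x ∈ S', ∑ y ∈ (Λ \ S').filter ((spreadOutGraph d L).Adj x),
          Real.tanh β * isingTwoPoint (spreadOutGraph d L) S' β 0 .free a x * B := by
        refine Finset.sum_le_sum fun x hx => Finset.sum_le_sum fun y hy => ?_
        have hy' := Finset.mem_filter.1 hy
        have hyΛS := Finset.mem_sdiff.1 hy'.1
        have hyT : y ∉ T := fun hyT => hyΛS.2 (Finset.mem_inter.2 ⟨hyT, hyΛS.1⟩)
        exact mul_le_mul_of_nonneg_left (hB y hyΛS.1 hyT ⟨x, hS'T hx, hy'.2⟩)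
          (mul_nonneg htanh (isingTwoPoint_free_nonneg _ hβ haS' hx))
    _ = (Real.tanh β * ∑ x ∈ S', ((((Λ \ S').filter ((spreadOutGraph d L).Adj x)).card : ℝ) *
          isingTwoPoint (spreadOutGraph d L) S' β 0 .free a x)) * B := by
        rw [Finset.mul_sum, Finset.sum_mul]
        refine Finset.sum_congr rfl fun x _ => ?_
        rw [Finset.sum_const, nsmul_eq_mul]
        ring
    _ ≤ soPhi d L β S * B := by
        refine mul_le_mul_of_nonneg_right ?_ hB0
        exact mul_le_mul_of_nonneg_left (boundary_sum_inter_le hβ h0 ha) htanh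

/-- Adjacent sites are within sup-distance `L`. [folklore] -/
theorem supNorm_sub_le_of_adj {x y : Site d} (hxy : (spreadOutGraph d L).Adj x y) :
    Site.supNorm (y - x) ≤ L := by
  rw [spreadOutGraph_adj_iff] at hxy
  rw [Site.supNorm_le_iff]
  intro i
  have h := hxy.2 i
  rw [abs_sub_comm, Int.abs_eq_natAbs] at h
  exact_mod_cast h

/-- **The iteration**: for `β ≥ 0`, `0 ∈ S ⊆ Λ_m`, a finite volume `Λ` and `k ∈ ℕ`,
`⟨σ_aσ_z⟩^∅_{Λ;β} ≤ φ_β(S)^k` for all `a, z ∈ Λ` with `‖z - a‖_∞ > k(m + L)`: each step of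
`isingTwoPoint_le_soPhi_mul` moves the starting point by at most `m + L` (a site adjacent to
`S + a ⊆ Λ_m + a` lies in `Λ_{m+L} + a`). ("The proof follows by iterating `⌊n/L⌋` times this
strategy", Duminil-Copin–Tassion 2016, end of §2.5.) [cite: DuminilCopinTassionCMP2016, §2.5 (proof of the third item of Thm. 2.1) (arXiv:1502.03050 numbering)] -/
theorem isingTwoPoint_le_soPhi_pow {β : ℝ} (hβ : 0 ≤ β) {S : Finset (Site d)}
    (h0 : (0 : Site d) ∈ S) {m : ℕ} (hSm : S ⊆ box d m) (Λ : Finset (Site d)) (k : ℕ)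
    {a z : Site d} (ha : a ∈ Λ) (hz : z ∈ Λ) (hdist : k * (m + L) < Site.supNorm (z - a)) :
    isingTwoPoint (spreadOutGraph d L) Λ β 0 .free a z ≤ soPhi d L β S ^ k := by
  induction k generalizing a with
  | zero =>
    rw [pow_zero]
    exact (le_abs_self _).trans (abs_isingTwoPoint_le_one _ _ _ _ _ _ _)
  | succ k ih =>
    have hk : (k + 1) * (m + L) = k * (m + L) + (m + L) := by ring
    -- `z ∉ S + a` since `‖z - a‖_∞ > m`
    have hzS : z ∉ S.map (Site.shift a).toEmbedding := by
      intro h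
      have h' := mem_box_iff_supNorm_le.1 (hSm ((mem_map_shift_iff' _ _ _).1 h))
      omega
    rw [pow_succ']
    refine isingTwoPoint_le_soPhi_mul hβ h0 ha hz hzS (pow_nonneg (soPhi_nonneg hβ h0) k) ?_
    rintro y hy - ⟨x, hx, hxy⟩
    refine ih hy ?_
    have hxa : Site.supNorm (x - a) ≤ m :=
      mem_box_iff_supNorm_le.1 (hSm ((mem_map_shift_iff' _ _ _).1 hx))
    have hyx : Site.supNorm (y - x) ≤ L := supNorm_sub_le_of_adj hxy
    have hya : Site.supNorm (y - a) ≤ m + L := by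
      have h := Site.supNorm_add_le (y - x) (x - a)
      rw [sub_add_sub_cancel] at h
      omega
    have htri : Site.supNorm (z - a) ≤ Site.supNorm (z - y) + Site.supNorm (y - a) := by
      have h := Site.supNorm_add_le (z - y) (y - a)
      rwa [sub_add_sub_cancel] at h
    omega

/-- **Infinite volume**: `G_β(z) ≤ φ_β(S)^k` whenever `‖z‖_∞ > k(m + L)` (`β ≥ 0`, `0 ∈ S ⊆ Λ_m`).
[cite: DuminilCopinTassionCMP2016, §2.5 (proof of the third item of Thm. 2.1) (arXiv:1502.03050 numbering)] -/
theorem spreadOutTwoPoint_le_soPhi_pow {β : ℝ} (hβ : 0 ≤ β) {S : Finset (Site d)}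
    (h0 : (0 : Site d) ∈ S) {m : ℕ} (hSm : S ⊆ box d m) (k : ℕ) {z : Site d}
    (hdist : k * (m + L) < Site.supNorm z) : spreadOutTwoPoint d L β z ≤ soPhi d L β S ^ k := by
  refine ciSup_le fun N => ?_
  by_cases hz : z ∈ box d N
  · exact isingTwoPoint_le_soPhi_pow hβ h0 hSm (box d N) k (zero_mem_box d N) hz
      (by simpa using hdist)
  · rw [boxTwoPoint_of_not_mem β hz]
    exact pow_nonneg (soPhi_nonneg hβ h0) k

/-- **Exponential decay from a finite-size certificate** (the third item of Duminil-Copin–Tassion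
2016, Thm. 2.1, in their `φ_β(S) < 1` form, for the free-boundary two-point function of the
spread-out model): if `φ_β(S) < 1` for a finite `S ∋ 0` and `β ≥ 0`, then
`G_β(z) ≤ C e^{-c‖z‖_∞}` for some `C` and `c > 0`. (With `S ⊆ Λ_m`, `R = m + L + 1`,
`φ' = φ_β(S) ∨ ½`: `G_β(z) ≤ φ'^{⌊‖z‖_∞/R⌋} ≤ φ'⁻¹ e^{(log φ'/R)‖z‖_∞}`.)
[cite: DuminilCopinTassionCMP2016, Thm. 2.1 (third item) and §2.5 (arXiv:1502.03050 numbering)] -/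
theorem spreadOutTwoPoint_exp_decay_of_soPhi_lt_one {β : ℝ} (hβ : 0 ≤ β) {S : Finset (Site d)}
    (h0 : (0 : Site d) ∈ S) (hφ : soPhi d L β S < 1) :
    ∃ C c : ℝ, 0 < c ∧ ∀ z : Site d,
      spreadOutTwoPoint d L β z ≤ C * Real.exp (-c * Site.supNorm z) := by
  obtain ⟨m, hSm⟩ := (eventually_subset_box' S).exists
  set φ' : ℝ := max (soPhi d L β S) (1 / 2) with hφ'
  have hφ'pos : 0 < φ' := lt_of_lt_of_le (by norm_num) (le_max_right _ _)
  have hφ'lt : φ' < 1 := max_lt hφ (by norm_num)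
  have hφle : soPhi d L β S ≤ φ' := le_max_left _ _
  have hφ0 : 0 ≤ soPhi d L β S := soPhi_nonneg hβ h0
  have hlog : Real.log φ' < 0 := Real.log_neg hφ'pos hφ'lt
  set R : ℕ := m + L + 1 with hR
  have hRpos : (0 : ℝ) < R := by positivity
  refine ⟨φ'⁻¹, -Real.log φ' / R, div_pos (neg_pos.2 hlog) hRpos, fun z => ?_⟩
  set s : ℕ := Site.supNorm z with hs
  set k : ℕ := s / R with hk
  -- `G_β(z) ≤ φ'^k`
  have hG : spreadOutTwoPoint d L β z ≤ φ' ^ k := by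
    rcases Nat.eq_zero_or_pos k with hk0 | hkpos
    · rw [hk0, pow_zero]; exact spreadOutTwoPoint_le_one β z
    · have hkR : k * R ≤ s := Nat.div_mul_le_self s R
      have hdist : k * (m + L) < Site.supNorm z := by
        have h1 : k * R = k * (m + L) + k := by rw [hR]; ring
        omega
      exact (spreadOutTwoPoint_le_soPhi_pow hβ h0 hSm k hdist).trans
        (pow_le_pow_left₀ hφ0 hφle k)
  -- `φ'^k ≤ φ'⁻¹ exp((log φ'/R) s)` since `k > s/R - 1`
  have hks : (s : ℝ) / R - 1 < k := by
    have h1 : s < R * (k + 1) := by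
      have := Nat.div_add_mod s R
      have := Nat.mod_lt s (show 0 < R by positivity)
      rw [hk]; nlinarith
    have h2 : (s : ℝ) < R * (k + 1) := by exact_mod_cast h1
    rw [div_sub_one hRpos.ne', div_lt_iff₀ hRpos]
    nlinarith
  refine hG.trans ?_
  rw [← Real.rpow_natCast, Real.rpow_def_of_pos hφ'pos, ← Real.exp_log hφ'pos, ← Real.exp_neg,
    Real.log_exp, ← Real.exp_add]
  refine Real.exp_le_exp.2 ?_
  have : Real.log φ' * ((s : ℝ) / R - 1) = -Real.log φ' + -(-Real.log φ' / R) * s := by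
    field_simp
    ring
  nlinarith [mul_le_mul_of_nonpos_left hks.le hlog.le]

/-- **`χ_β < ∞` forces exponential decay of `G_β`** (`β ≥ 0`): a finite susceptibility yields a box
with `φ_β(Λ_n) < 1` (`exists_soPhi_box_lt_one`), and the iteration applies. For the spread-out
Ising model this is the passage from the second to the third item of Duminil-Copin–Tassion 2016,
Thm. 2.1 (finite-range couplings). [cite: DuminilCopinTassionCMP2016, Thm. 2.1 and §2.5 (arXiv:1502.03050 numbering)] -/
theorem spreadOutTwoPoint_exp_decay_of_susceptibility_lt_top {β : ℝ} (hβ : 0 ≤ β)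
    (hχ : spreadOutSusceptibility d L β < ∞) :
    ∃ C c : ℝ, 0 < c ∧ ∀ z : Site d,
      spreadOutTwoPoint d L β z ≤ C * Real.exp (-c * Site.supNorm z) := by
  set m : ℝ := (spreadOutSusceptibility d L β).toReal with hm
  have hχm : spreadOutSusceptibility d L β ≤ ENNReal.ofReal m := (ENNReal.ofReal_toReal hχ.ne).ge
  obtain ⟨n, hn⟩ := exists_soPhi_box_lt_one hβ ENNReal.toReal_nonneg hχm
  exact spreadOutTwoPoint_exp_decay_of_soPhi_lt_one hβ (zero_mem_box d n) hn

/-- **Sharpness, third item, for the spread-out Ising model** (`d ≥ 2`, `L ≥ 1`): for every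
`0 ≤ β < β_c` there are `C` and `c > 0` with `G_β(z) ≤ C e^{-c‖z‖_∞}` for all `z` — "`G_p(x)`
decays exponentially as `|x| ↑ ∞` … if `p < p_c`" (Sakai 2007, §1.1; Aizenman–Barsky–Fernández
1987; Duminil-Copin–Tassion 2016, Thm. 2.1, third item), here with `β_c = sup{β ≥ 0 : χ_β < ∞}` so
that `χ_β < ∞` below `β_c` by monotonicity. In particular `G_β(x) = o(|x|^{-(d-2)})` below `β_c`.
[cite: Sakai2007, §1.1 (G_p decays exponentially for p < p_c)]
[cite: DuminilCopinTassionCMP2016, Thm. 2.1 (third item) (arXiv:1502.03050 numbering)]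
[cite: AizenmanBarskyFernandezJSP1987, Thm. 1] -/
theorem spreadOutTwoPoint_exp_decay_of_lt_critBeta (hd : 2 ≤ d) (hL : 1 ≤ L) {β : ℝ}
    (hβ : 0 ≤ β) (hβc : β < critBeta d L) :
    ∃ C c : ℝ, 0 < c ∧ ∀ z : Site d,
      spreadOutTwoPoint d L β z ≤ C * Real.exp (-c * Site.supNorm z) := by
  obtain ⟨β₀, hβ₀, hfin₀⟩ := exists_pos_susceptibility_lt_top_holds d L hd hL
  exact spreadOutTwoPoint_exp_decay_of_susceptibility_lt_top hβ
    (susceptibility_lt_top_of_lt_critBeta ⟨β₀, hβ₀.le, hfin₀⟩ hβ hβc)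

/-! ### `IsingBubbleMeanField` from the one remaining named fact -/

/-- **`IsingBubbleMeanField` (bubble condition ⇒ `γ = 1`, spread-out model) reduced to the single
named fact `bubble_susceptibility_upper`** (Aizenman's upper bound `χ_β ≤ C (β_c - β)⁻¹` under
the bubble condition): the four other inputs of `IsingBubbleMeanField_of_facts` are now theorems
(`inv_susceptibility_sub_le_holds` of the proofs file and the three discharges above).
[cite: Sakai2007, §1.1 (bubble condition ⇒ γ = 1)] [cite: Aizenman1982, as cited by Sakai 2007 §1.1 ([a82])] -/
theorem IsingBubbleMeanField_of_bubble_susceptibility_upper (h5 : bubble_susceptibility_upper) :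
    IsingBubbleMeanField :=
  IsingBubbleMeanField_of_facts' exists_pos_susceptibility_lt_top_holds
    exists_forall_le_susceptibility_eq_top_holds susceptibility_unbounded_below_critBeta_holds h5

end Literature.Barriers.CriticalPhenomena.SpreadOutIsing

/-! ## Part II. The nearest-neighbour conjunct: `NNIsing.IsingBubbleMeanField` from one named fact -/

namespace Literature.Barriers.CriticalPhenomena.NNIsing

open Literature.Probability.LatticeModels
open scoped ENNReal

/-- **Bubble condition ⇒ `γ ≤ 1`, nearest-neighbour Ising model on `ℤ^d`, `d ≥ 2` (named fact;
Aizenman 1982, Aizenman–Graham 1983 as quoted by Sakai 2007, §1.1).** If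
`B(β_c) = Σ_x ⟨σ₀σ_x⟩²_{β_c} < ∞` (`NNIsing.BubbleCondition d`, over the tree's `twoPointFree`
and `criticalBeta d`), then there are `C` and `β₀ < β_c` with `χ(β) ≤ C (β_c - β)⁻¹` for all
`β ∈ (β₀, β_c)` — the upper half of "`χ_p ≍ (p_c - p)⁻¹`", i.e. of "the finiteness of
`Σ_{x∈ℤ^d} G_{p_c}(x)²` … implies that `β = 1/2`, `γ = 1` and `δ = 3` [a82, abf87, af86, ag83]"
(Sakai 2007, §1.1, stated for translation-invariant `ℤ^d`-symmetric finite-range `J ≥ 0`, the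
nearest-neighbour interaction `J_{o,x} = 1{‖x‖₁ = 1}` included). Mechanism, printed for this very
model (`|J| = 2d`): "for `h = 0` and `β < β_c`, `(1 - B/χ)·2dχ²/(1+B) ≤ ∂_β χ ≤ 2dχ²` … Since …
`B(β)` remains bounded uniformly in `β < β_c` …, `χ(β)` must blow up like `1/|β - β_c|`"
(Duminil-Copin 2022, §7.1). The nearest-neighbour twin of
`SpreadOutIsing.bubble_susceptibility_upper`; the one ingredient of `NNIsing.IsingBubbleMeanField`
not available in the tree (Aizenman's random-current lower bound on `∂_β χ`). Named fact, not
proved here.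
[cite: Sakai2007, §1.1 (bubble condition ⇒ γ = 1)]
[cite: Aizenman1982, as cited by Sakai 2007 §1.1 ([a82])]
[cite: AizenmanGraham1983, as cited by Sakai 2007 §1.1 ([ag83])]
[cite: DuminilCopinICM2022, §7.1 (differential inequality for χ with the bubble diagram)] -/
def bubble_susceptibility_upper : Prop :=
  ∀ d : ℕ, 2 ≤ d → BubbleCondition d →
    ∃ C β₀ : ℝ, β₀ < criticalBeta d ∧ ∀ β : ℝ, β₀ < β → β < criticalBeta d →
      Literature.Probability.LatticeModels.susceptibility d β ≤
        ENNReal.ofReal (C * (criticalBeta d - β)⁻¹)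

/-- **The lower half of `NNIsing.HasGammaOne` is a theorem** (the mean-field bound `γ ≥ 1`,
`SusceptibilityMeanFieldBound.lean`): for `d ≥ 2` and `0 ≤ β < β_c`,
`(4d)⁻¹ (β_c - β)⁻¹ ≤ χ(β)`. [cite: Sakai2007, §1.1 (γ ≥ 1)] [cite: DuminilCopinICM2022, §7.1 (∂_β χ ≤ 2dχ²)] -/
theorem susceptibility_lower {d : ℕ} (hd : 2 ≤ d) {β : ℝ} (hβ : 0 ≤ β)
    (hβc : β < criticalBeta d) :
    ENNReal.ofReal ((4 * d : ℝ)⁻¹ * (criticalBeta d - β)⁻¹) ≤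
      Literature.Probability.LatticeModels.susceptibility d β := by
  have h := susceptibility_meanField_lower_bound hd hβ hβc
  rwa [mul_inv] at h

/-- **`NNIsing.IsingBubbleMeanField` (bubble condition ⇒ `γ = 1`, nearest-neighbour model,
`d ≥ 2`) from the single named fact `NNIsing.bubble_susceptibility_upper`**: the lower bound
`χ(β) ≥ (4d)⁻¹(β_c - β)⁻¹` on `[0, β_c)` and `0 < β_c` are tree theorems
(`susceptibility_meanField_lower_bound`, `criticalBeta_pos_holds`), the upper bound is the fact.
[cite: Sakai2007, §1.1 (bubble condition ⇒ γ = 1)] [cite: DuminilCopinICM2022, §7.1] -/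
theorem IsingBubbleMeanField_of_bubble_susceptibility_upper (h : bubble_susceptibility_upper) :
    IsingBubbleMeanField := by
  intro d hd hB
  obtain ⟨C, β₀, hβ₀, hup⟩ := h d hd hB
  have hpos : 0 < criticalBeta d := criticalBeta_pos_holds hd
  refine ⟨(4 * d : ℝ)⁻¹, C, max β₀ 0, by positivity, max_lt hβ₀ hpos, fun β hβl hβc => ⟨?_, ?_⟩⟩
  · exact susceptibility_lower hd ((le_max_right _ _).trans_lt hβl).le hβc
  · exact hup β ((le_max_left _ _).trans_lt hβl) hβc

end Literature.Barriers.CriticalPhenomena.NNIsing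

/-! ## Part III. The barrier from three named facts -/

namespace Literature.Barriers.CriticalPhenomena

/-- **`LaceExpansionIsingAboveFour` reduced to three named facts**: Aizenman's bubble bound
`B(β_c) < ∞ ⇒ χ_β ≤ C(β_c - β)⁻¹` for the nearest-neighbour model
(`NNIsing.bubble_susceptibility_upper`) and for the spread-out model
(`SpreadOutIsing.bubble_susceptibility_upper`), and Sakai's Theorem 1.3 in the spread-out case
(`SpreadOutIsing.Sakai2007_thm13_spreadOut`). Everything else in the three conjuncts — the
mean-field lower bounds `γ ≥ 1`, `0 < β_c < ∞` as a genuine supremum, `χ_β < ∞` below and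
`= ∞` above `β_c`, the divergence `χ_β ↑ ∞` as `β ↑ β_c` — is proved in the tree
(`SusceptibilityMeanFieldBound.lean`, `LaceExpansionIsingAboveFourProofs.lean`, this file).
[cite: Sakai2007, §1.1 and Theorem 1.3] -/
theorem LaceExpansionIsingAboveFour_of_facts (h₁ : NNIsing.bubble_susceptibility_upper)
    (h₂ : SpreadOutIsing.bubble_susceptibility_upper)
    (h₃ : SpreadOutIsing.Sakai2007_thm13_spreadOut) : LaceExpansionIsingAboveFour :=
  ⟨NNIsing.IsingBubbleMeanField_of_bubble_susceptibility_upper h₁,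
    SpreadOutIsing.IsingBubbleMeanField_of_bubble_susceptibility_upper h₂, h₃⟩

end Literature.Barriers.CriticalPhenomena

end
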